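import Literature.NumberTheory.EllipticCurves.InertiaFixedTorsionOfTamagawaProofs
import Literature.NumberTheory.EllipticCurves.LocalPointsIntegersSubgroup
import Literature.NumberTheory.EllipticCurves.FormalGroupDivision
import Literature.NumberTheory.EllipticCurves.ReductionHomomorphismCuspNodeProofs
import HarnessLib

/-!
# Additive (cuspidal) reduction, `v ∤ n`: `E₁(K_v)` and `E₀(K_v)` are `n`-divisible; `p ∣ [E(K_v) : E₀(K_v)]`
# ⇒ a `K_v`-RATIONAL `p`-torsion point off `E₀` (theorems only)

`Proofs` file (theorems only: no definition, no named fact, no instance), topic `NumberTheory/EllipticCurves`;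
third file of the series `InertiaFixedTorsionAdditiveIndexBoundProofs` ("`E[3]^{I_v}` is at most a line"),
`InertiaFixedTorsionOfTamagawaProofs` ("exactly a line when `3 ∣ c_v`").  Here the `K_v`-RATIONAL version:

* `exists_nsmul_eq_of_mem_kernel_adicCompletion` — **`E₁(K_v)` is `n`-divisible for `v ∤ n`** (Silverman *AEC*
  IV.2.3 / IV.6.4: `[n]` is an automorphism of `Ê(𝓂_v)` for a unit `n`; the tree's chart-theoretic division
  theorem `FormalGroupChart.map_nsmul_kernelLevel_eq` over the complete field `K_v`, with the inputs
  `LocalPoints.hlift` (Hensel) and `LocalPoints.exists_limit_of_geometric` (completeness) of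
  `LocalPointsIntegersSubgroup`; the proof of `Kramer1981.exists_two_nsmul_eq_of_reducesToZero` with `2 ↦ n`).
* `exists_nsmul_eq_of_hasNonsingularReduction_of_cusp` — **`E₀(K_v)` is `n`-divisible at a place of ADDITIVE
  reduction, `v ∤ n`**: for an `𝓞_v`-equation `X₀` with `Δ, c₄ ∈ 𝓂_v` (cuspidal reduction), reduction is a
  homomorphism `E₀ → Ẽ_ns(k̄) ≅ k̄⁺` with kernel `E₁` (tree `exists_addMonoidHom_residueField_of_cusp`, read over
  `𝒪_w ⊆ K̄_v`), `k̄⁺` is killed by the residue characteristic `q`, so for `n m ≡ 1 (mod q)` the point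
  `n m • P − P` lies in `E₁(K_v) = n • E₁(K_v)`.  (Silverman *AEC* VII.2.1, III.2.5; Greenberg LNM 1716 p. 88.)
* `exists_torsion_not_mem_nonsingularReductionSubgroup_of_dvd_index` — **`p ∣ [X₀(K_v) : E₀(K_v)]`, cusp,
  `v ∤ p` ⇒ a `K_v`-RATIONAL `p`-torsion point off `E₀`** (hence `≠ O`): `E(K_v)[p] ↠ Φ_v(k)[p]`.
The GLOBAL readings (`E/K` over a number field, `v` additive, `p ∣ c_v`: a point of `E[p] ∖ O` fixed by the
whole decomposition group `Γ_{K_v}`; at `p = 3` the line `E[3]^{I_v}` carries the TRIVIAL `Γ_{K_v}`-action — the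
`χ_sub = 1` half of the shadow lemma of line `shadow_seed`, crux `KobayashiLowerHalfLargeImage` /
stmt-BirchSwinnertonDyer-19001) are the sequel file.  Nothing is asserted about any curve; BSD is not proved by
any of this.

## References

* [SilvermanAEC2009] J. H. Silverman, *The Arithmetic of Elliptic Curves*, 2nd ed., GTM 106 (2009): Prop. IV.2.3,
  IV.3.2, Thm. IV.6.4 (b), Props. VII.2.1–2.2, VII.3.1 (PDF pp. 166–171), Thm. VII.6.1 (PDF p. 177), III.2.5.
* [GreenbergLNM1716] R. Greenberg, LNM 1716 (1999), §3 p. 88 ("`c_v^{(p)} = |E(F_v)_p|`" at additive `v`).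

Design: no definitions; one universe `u`; the `𝒪_w`-model `W₀ = X₀.map φ₀` and the `K_v`-points read in
`K̄_v` follow `MazurTorsionStepFourProofs` / `InertiaFixedTorsionOfTamagawaProofs` verbatim.
-/

noncomputable section

open scoped Classical NNReal Pointwise
open NumberField IsDedekindDomain

universe u

namespace WeierstrassCurve

open Literature.NumberTheory.EllipticCurves Literature.NumberTheory.GaloisRepresentations Field
  IsDedekindDomain.HeightOneSpectrum Literature.NumberTheory.EllipticCurves.FormalGroupChart

variable {K : Type u} [Field K] [NumberField K] {v : HeightOneSpectrum (𝓞 K)}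

/-! ## `E₁(K_v)` is `n`-divisible for `v ∤ n` -/

/-- **The kernel of reduction `E₁(K_v)` is `n`-divisible for `v ∤ n`** (Silverman *AEC* IV.2.3 / IV.6.4 (b):
`[n]` is an automorphism of `Ê(𝓂_v)` for `n ∈ 𝓞_vˣ`): for an `𝓞_v`-equation `X₀` with `X₀ ⊗ K_v` elliptic
and a natural number `n ∉ v`, every `P ∈ E₁(K_v)` (`FormalGroupChart.kernel` for the norm valuation) is
`n • Q` with `Q ∈ E₁(K_v)`.  Proof: `P` lies in the level `U_ρ`, `ρ = ‖z(P)‖ < 1 = ‖n‖`, and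
`n • U_ρ = U_ρ` (`FormalGroupChart.map_nsmul_kernelLevel_eq` with `LocalPoints.hlift`,
`LocalPoints.exists_limit_of_geometric`).
[cite: SilvermanAEC2009, Prop. IV.2.3 and Thm. IV.6.4(b); Prop. VII.2.2] -/
theorem exists_nsmul_eq_of_mem_kernel_adicCompletion (X₀ : WeierstrassCurve (v.adicCompletionIntegers K))
    [(X₀.baseChange (v.adicCompletion K)).IsElliptic]
    [(X₀.baseChange (v.adicCompletion K)).IsIntegral
      ((NormedField.valuation : Valuation (v.adicCompletion K) ℝ≥0)).integer]
    {n : ℕ} (hn : (n : 𝓞 K) ∉ v.asIdeal)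
    {P : (X₀.baseChange (v.adicCompletion K)).toAffine.Point}
    (hP : P ∈ kernel (NormedField.valuation : Valuation (v.adicCompletion K) ℝ≥0)
      (X₀.baseChange (v.adicCompletion K))) :
    ∃ Q ∈ kernel (NormedField.valuation : Valuation (v.adicCompletion K) ℝ≥0)
      (X₀.baseChange (v.adicCompletion K)), n • Q = P := by
  set ν : Valuation (v.adicCompletion K) ℝ≥0 := NormedField.valuation with hν
  set ρ : ℝ≥0 := ν P.zCoord with hρ
  have hρ1 : ρ < 1 := val_zCoord_lt_one hP
  have hνn : ν (n : v.adicCompletion K) = 1 := LocalPoints.valuation_natCast_eq_one v hn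
  have hρn : ρ < ν ((n : ℕ) : v.adicCompletion K) := by rw [hνn]; exact hρ1
  have hmap := map_nsmul_kernelLevel_eq (w := ν) (V := X₀.baseChange (v.adicCompletion K)) (N := n) hρn
    (LocalPoints.hlift v X₀ hρ1) (LocalPoints.exists_limit_of_geometric v)
  rw [hνn, one_mul] at hmap
  have hPlevel : P ∈ kernelLevel ν (X₀.baseChange (v.adicCompletion K)) ρ := ⟨hP, le_rfl⟩
  rw [← hmap] at hPlevel
  obtain ⟨Q, hQ, hQP⟩ := hPlevel
  exact ⟨Q, hQ.1, by simpa using hQP⟩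

/-! ## `E₀(K_v)` is `n`-divisible at a cusp, `v ∤ n`; a rational `p`-torsion point off `E₀` when `p ∣ c_v` -/

section Cusp

variable {w : Valuation (AlgebraicClosure (v.adicCompletion K)) ℝ≥0}
  (hw : ∀ x, (w x : ℝ) = spectralNorm (v.adicCompletion K) (AlgebraicClosure (v.adicCompletion K)) x)

include hw in
set_option maxHeartbeats 1600000 in
/-- **`E₀(K_v)` is `n`-divisible at a place of additive reduction, `v ∤ n`.**  For an `𝓞_v`-equation `X₀`
with `X₀ ⊗ K_v` elliptic and CUSPIDAL reduction (`Δ, c₄ ∈ 𝓂_v`), every `P ∈ E₀(K_v)`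
(`X₀.nonsingularReductionSubgroup`) is `n • Q` with `Q ∈ E₀(K_v)`, for every natural number `n ∉ v`.  Proof:
read `P` in `X₀(K̄_v)` on the `𝒪_w`-model `W₀ = X₀.map φ₀`; reduction `E₀ → Ẽ_ns(k̄) ≅ k̄⁺` is a homomorphism
with kernel `E₁` (`exists_addMonoidHom_residueField_of_cusp`) and `k̄⁺` is killed by the residue
characteristic `q`; with `n m ≡ 1 (mod q)` the rational point `n m • P − P` reduces to `Õ`, so lies in
`E₁(K_v) = n • E₁(K_v)` (`exists_nsmul_eq_of_mem_kernel_adicCompletion`), whence `P = n • (m • P − Q₁)`.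
[cite: SilvermanAEC2009, Props. VII.2.1, VII.2.2 and III.2.5] [cite: GreenbergLNM1716, §3 p. 88] -/
theorem exists_nsmul_eq_of_hasNonsingularReduction_of_cusp (X₀ : WeierstrassCurve (v.adicCompletionIntegers K))
    [(X₀.baseChange (v.adicCompletion K)).IsElliptic]
    {𝔐 : Ideal v.localAbsIntegers} (h𝔐 : 𝔐 ∈ v.localPrimesAbove)
    (hΔ : X₀.Δ ∈ IsLocalRing.maximalIdeal (v.adicCompletionIntegers K))
    (hc₄ : X₀.c₄ ∈ IsLocalRing.maximalIdeal (v.adicCompletionIntegers K))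
    {n : ℕ} (hn : (n : 𝓞 K) ∉ v.asIdeal)
    {P : (X₀.baseChange (v.adicCompletion K)).toAffine.Point}
    (hP : P ∈ X₀.nonsingularReductionSubgroup
      (integers_valuationRing_valuation (v.adicCompletionIntegers K) (v.adicCompletion K))) :
    ∃ Q ∈ X₀.nonsingularReductionSubgroup
      (integers_valuationRing_valuation (v.adicCompletionIntegers K) (v.adicCompletion K)), n • Q = P := by
  have hv0 : w.Integers w.integer := Valuation.integer.integers w
  have hvR := integers_valuationRing_valuation (v.adicCompletionIntegers K) (v.adicCompletion K)
  haveI := LocalPoints.isIntegral_baseChange v X₀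
  set H := X₀.nonsingularReductionSubgroup hvR with hH
  /- the residue characteristic `q ∈ v`, and `m` with `n m ≡ 1 (mod q)` -/
  haveI : v.asIdeal.IsPrime := v.isPrime
  obtain ⟨q, hqchar⟩ := CharP.exists (𝓞 K ⧸ v.asIdeal)
  have hq : q.Prime := (CharP.char_is_prime_or_zero (𝓞 K ⧸ v.asIdeal) q).resolve_right
    (CharP.char_ne_zero_of_finite (𝓞 K ⧸ v.asIdeal) q)
  have hqv : (q : 𝓞 K) ∈ v.asIdeal := by
    rw [← Ideal.Quotient.eq_zero_iff_mem, map_natCast]; exact CharP.cast_eq_zero _ q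
  have hqn : Nat.Coprime n q := by
    refine Nat.Coprime.symm ((Nat.Prime.coprime_iff_not_dvd hq).mpr fun hdvd ↦ hn ?_)
    obtain ⟨k, rfl⟩ := hdvd
    rw [Nat.cast_mul]; exact v.asIdeal.mul_mem_right _ hqv
  obtain ⟨m, -, hm⟩ := Nat.exists_mul_mod_eq_one_of_coprime hqn hq.one_lt
  obtain ⟨t, ht⟩ : ∃ t : ℕ, n * m = q * t + 1 := ⟨n * m / q, by
    have := Nat.div_add_mod (n * m) q; rw [hm] at this; exact this.symm⟩
  /- the `𝒪_w`-model `W₀ = X₀.map φ₀` -/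
  set f : v.adicCompletionIntegers K →+* AlgebraicClosure (v.adicCompletion K) :=
    (algebraMap (v.adicCompletion K) (AlgebraicClosure (v.adicCompletion K))).comp
      (algebraMap (v.adicCompletionIntegers K) (v.adicCompletion K)) with hfdef
  have hfle : ∀ a, f a ∈ w.integer := fun a ↦
    (spectralValuation_algebraMap_le_one_iff hw _).mpr a.2
  set φ₀ : v.adicCompletionIntegers K →+* w.integer := f.codRestrict w.integer hfle with hφ₀def
  have hφ₀ : ∀ a, ((φ₀ a : w.integer) : AlgebraicClosure (v.adicCompletion K)) = f a := fun a ↦ rfl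
  haveI hφ₀loc : IsLocalHom φ₀ := ⟨fun a ha ↦ by
    by_contra hna
    have hmem : a ∈ IsLocalRing.maximalIdeal (v.adicCompletionIntegers K) :=
      (IsLocalRing.mem_maximalIdeal _).mpr (mem_nonunits_iff.mpr hna)
    have hlt : w (f a) < 1 := spectralValuation_algebraMap_lt_one_of_mem_maximalIdeal hw h𝔐 hmem
    have h1 : w (f a) = 1 := by
      rw [← hφ₀]; exact (hv0.isUnit_iff_valuation_eq_one).mp ha
    exact absurd h1 hlt.ne⟩
  set W₀ : WeierstrassCurve w.integer := X₀.map φ₀ with hW₀def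
  have hX : (X₀.baseChange (v.adicCompletion K)).baseChange (AlgebraicClosure (v.adicCompletion K)) =
      W₀.baseChange (AlgebraicClosure (v.adicCompletion K)) := by
    rw [hW₀def]
    change (X₀.map _).map _ = (X₀.map φ₀).map (algebraMap w.integer _)
    rw [map_map, map_map]
    congr 1
  haveI hint : ((X₀.baseChange (v.adicCompletion K)).baseChange
      (AlgebraicClosure (v.adicCompletion K))).IsIntegral w.integer := ⟨W₀, hX⟩
  have hκ : W₀.map (IsLocalRing.residue w.integer) =
      ((X₀.map (IsLocalRing.residue (v.adicCompletionIntegers K))).map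
        (IsLocalRing.ResidueField.map φ₀)) := by
    rw [hW₀def]
    simp only [map_map]
    congr 1
  have hres0 : ∀ a ∈ IsLocalRing.maximalIdeal (v.adicCompletionIntegers K),
      IsLocalRing.residue w.integer (φ₀ a) = 0 := fun a ha ↦
    (IsLocalRing.residue_eq_zero_iff _).mpr (map_nonunit φ₀ a ((IsLocalRing.mem_maximalIdeal _).mp ha))
  have hΔ0 : IsLocalRing.residue w.integer W₀.Δ = 0 := by rw [hW₀def, map_Δ]; exact hres0 _ hΔ
  have hc₄0 : IsLocalRing.residue w.integer W₀.c₄ = 0 := by rw [hW₀def, map_c₄]; exact hres0 _ hc₄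
  obtain ⟨rc, hrc⟩ := W₀.exists_addMonoidHom_residueField_of_cusp hv0 hΔ0 hc₄0
  -- `q = 0` in `k̄`
  have hqk : ((q : ℕ) : AlgebraicClosure (IsLocalRing.ResidueField w.integer)) = 0 := by
    have hqO : ((q : ℕ) : v.adicCompletionIntegers K) ∈ IsLocalRing.maximalIdeal (v.adicCompletionIntegers K) := by
      rw [LocalPoints.mem_maximalIdeal_iff]
      have := LocalPoints.valuation_natCast_lt_one v hqv
      simpa using this
    have h1 := hres0 _ hqO
    rw [map_natCast, map_natCast] at h1
    rw [← map_natCast (algebraMap (IsLocalRing.ResidueField w.integer)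
      (AlgebraicClosure (IsLocalRing.ResidueField w.integer))), h1, map_zero]
  /- `K_v`-points read in `K̄_v` -/
  set ι : v.adicCompletion K →ₐ[v.adicCompletion K] AlgebraicClosure (v.adicCompletion K) :=
    Algebra.ofId (v.adicCompletion K) (AlgebraicClosure (v.adicCompletion K)) with hιdef
  set j := Affine.Point.map (W' := (X₀.baseChange (v.adicCompletion K)).toAffine)
    (S := v.adicCompletion K) ι with hjdef
  -- `E₀(K_v)` maps into `E₀` of `W₀`, `E₁` of `W₀` pulls back to `E₁(K_v)`
  have hE₀ : ∀ T : (X₀.baseChange (v.adicCompletion K)).toAffine.Point, T ∈ H →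
      W₀.HasNonsingularReduction (Affine.Point.congrEquiv hX (j T)) := by
    intro T hT
    rw [hH, mem_nonsingularReductionSubgroup_iff] at hT
    rcases point_cases hvR T with rfl | ⟨x, y, h, rfl, hx⟩ | ⟨a, c, h, rfl⟩
    · have hj0 : j (0 : ((X₀.baseChange (v.adicCompletion K)).baseChange (v.adicCompletion K)).toAffine.Point) = 0 :=
        map_zero j
      show W₀.HasNonsingularReduction (Affine.Point.congrEquiv hX
        (j (0 : ((X₀.baseChange (v.adicCompletion K)).baseChange (v.adicCompletion K)).toAffine.Point)))
      rw [hj0, map_zero]; exact hasNonsingularReduction_zero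
    · have hxO : x ∉ v.adicCompletionIntegers K := fun hxO ↦
        (not_mem_range_iff hvR).mpr hx ⟨⟨x, hxO⟩, rfl⟩
      have hιx : 1 < w (ι x) := by
        rw [hιdef, Algebra.ofId_apply]
        exact not_le.mp fun hle ↦ hxO ((spectralValuation_algebraMap_le_one_iff hw x).mp hle)
      have h' : ((X₀.baseChange (v.adicCompletion K)).baseChange (v.adicCompletion K)).toAffine.Nonsingular
          x y := h
      show W₀.HasNonsingularReduction (Affine.Point.congrEquiv hX (j (.some _ _ h')))
      rw [hjdef, Affine.Point.map_some, Affine.Point.congrEquiv_some]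
      exact Or.inl ((not_mem_range_iff hv0).mpr hιx)
    · have hns := (hasNonsingularReduction_some_algebraMap_iff hvR.hom_inj h).mp hT
      have h' : ((X₀.baseChange (v.adicCompletion K)).baseChange (v.adicCompletion K)).toAffine.Nonsingular
          (algebraMap (v.adicCompletionIntegers K) (v.adicCompletion K) a)
          (algebraMap (v.adicCompletionIntegers K) (v.adicCompletion K) c) := h
      show W₀.HasNonsingularReduction (Affine.Point.congrEquiv hX (j (.some _ _ h')))
      rw [hjdef, Affine.Point.map_some, Affine.Point.congrEquiv_some]
      refine (hasNonsingularReduction_some_algebraMap_iff hv0.hom_inj (a := φ₀ a) (b := φ₀ c) _).mpr ?_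
      rw [hκ, ← IsLocalRing.ResidueField.map_residue, ← IsLocalRing.ResidueField.map_residue]
      exact (Affine.map_nonsingular _ (IsLocalRing.ResidueField.map φ₀).injective _ _).mpr hns
  have hE₁ : ∀ T : (X₀.baseChange (v.adicCompletion K)).toAffine.Point,
      W₀.ReducesToZero (Affine.Point.congrEquiv hX (j T)) →
        T ∈ kernel (NormedField.valuation : Valuation (v.adicCompletion K) ℝ≥0)
          (X₀.baseChange (v.adicCompletion K)) := by
    intro T hT
    rcases point_cases hvR T with rfl | ⟨x, y, h, rfl, hx⟩ | ⟨a, c, h, rfl⟩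
    · exact @AddSubgroup.zero_mem _ _
        (kernel (NormedField.valuation : Valuation (v.adicCompletion K) ℝ≥0)
          (X₀.baseChange (v.adicCompletion K)))
    · refine (some_mem_kernel_iff h).mpr ?_
      have hxO : x ∉ v.adicCompletionIntegers K := fun hxO ↦
        (not_mem_range_iff hvR).mpr hx ⟨⟨x, hxO⟩, rfl⟩
      rw [LocalPoints.valuation_apply, ← NNReal.coe_lt_coe, coe_nnnorm, NNReal.coe_one]
      exact not_le.mp fun hle ↦ hxO ((LocalPoints.norm_le_one_iff_mem v x).mp hle)
    · exfalso
      have h' : ((X₀.baseChange (v.adicCompletion K)).baseChange (v.adicCompletion K)).toAffine.Nonsingular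
          (algebraMap (v.adicCompletionIntegers K) (v.adicCompletion K) a)
          (algebraMap (v.adicCompletionIntegers K) (v.adicCompletion K) c) := h
      have hT' : W₀.ReducesToZero (Affine.Point.congrEquiv hX (j (.some _ _ h'))) := hT
      rw [hjdef, Affine.Point.map_some, Affine.Point.congrEquiv_some, reducesToZero_some_iff] at hT'
      exact hT' ⟨φ₀ a, rfl⟩
  /- the point `n m • P - P` reduces to `Õ` -/
  set P₀ : W₀.nonsingularReductionSubgroup hv0 := ⟨Affine.Point.congrEquiv hX (j P), hE₀ P hP⟩ with hP₀
  have hD : W₀.ReducesToZero (Affine.Point.congrEquiv hX (j ((n * m) • P - P))) := by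
    have hmem : W₀.HasNonsingularReduction (Affine.Point.congrEquiv hX (j ((n * m) • P - P))) :=
      hE₀ _ (H.sub_mem (H.nsmul_mem hP _) hP)
    set g : ((X₀.baseChange (v.adicCompletion K)).baseChange (v.adicCompletion K)).toAffine.Point →+
        (W₀.baseChange (AlgebraicClosure (v.adicCompletion K))).toAffine.Point :=
      (Affine.Point.congrEquiv hX).toAddMonoidHom.comp j with hgdef
    have hsub : (⟨_, hmem⟩ : W₀.nonsingularReductionSubgroup hv0) = (n * m) • P₀ - P₀ :=
      Subtype.ext (by
        simp only [hP₀, AddSubgroupClass.coe_sub, AddSubgroupClass.coe_nsmul]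
        exact (map_sub g ((n * m) • P) P).trans
          (congrArg (fun T ↦ T - g P) (map_nsmul g (n * m) P)))
    have h0 : rc ((n * m) • P₀ - P₀) = 0 := by
      rw [map_sub, map_nsmul, ht, add_nsmul, one_nsmul, mul_nsmul', nsmul_eq_mul (q : ℕ), hqk,
        zero_mul, zero_add, sub_self]
    have := (hrc _).mp h0
    rwa [← hsub] at this
  obtain ⟨Q₁, hQ₁, hQ₁eq⟩ := X₀.exists_nsmul_eq_of_mem_kernel_adicCompletion hn (hE₁ _ hD)
  -- `E₁(K_v) ⊆ E₀(K_v)`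
  have hQ₁H : Q₁ ∈ H := by
    rw [hH, mem_nonsingularReductionSubgroup_iff]
    rcases hQc : Q₁ with _ | ⟨x, y, hxy⟩
    · exact hasNonsingularReduction_zero
    · rw [hQc] at hQ₁
      have hx : 1 < (NormedField.valuation : Valuation (v.adicCompletion K) ℝ≥0) x :=
        (some_mem_kernel_iff hxy).mp hQ₁
      refine Or.inl fun ⟨a, ha⟩ ↦ ?_
      have hle : ‖x‖ ≤ 1 := (LocalPoints.norm_le_one_iff_mem v x).mpr (ha ▸ a.2)
      rw [LocalPoints.valuation_apply, ← NNReal.coe_lt_coe, coe_nnnorm, NNReal.coe_one] at hx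
      exact absurd hle (not_le.mpr hx)
  refine ⟨m • P - Q₁, H.sub_mem (H.nsmul_mem hP m) hQ₁H, ?_⟩
  rw [nsmul_sub, hQ₁eq, ← mul_nsmul', sub_sub_cancel]

include hw in
/-- **`p ∣ [X₀(K_v) : E₀(K_v)]` at a cusp, `v ∤ p` ⇒ a `K_v`-RATIONAL `p`-torsion point off `E₀`.**  With `X₀`
as above (cuspidal reduction), `p` a prime with `v ∤ p` dividing the finite non-zero index of `E₀(K_v)`:
some `R ∈ X₀(K_v)` has `p • R = O` and `R ∉ E₀(K_v)` (so `R ≠ O`).  An element of order `p` of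
`X₀(K_v)/E₀(K_v)` gives `P ∉ E₀` with `p • P ∈ E₀ = p • E₀`
(`exists_nsmul_eq_of_hasNonsingularReduction_of_cusp`); `R = P − Q`.  Greenberg: "`c_v^{(p)} = |E(F_v)_p|`".
[cite: GreenbergLNM1716, §3 p. 88] [cite: SilvermanAEC2009, Thm. VII.6.1 and Cor. VII.6.2 (PDF p. 177)] -/
theorem exists_torsion_not_mem_nonsingularReductionSubgroup_of_dvd_index
    (X₀ : WeierstrassCurve (v.adicCompletionIntegers K)) [(X₀.baseChange (v.adicCompletion K)).IsElliptic]
    {𝔐 : Ideal v.localAbsIntegers} (h𝔐 : 𝔐 ∈ v.localPrimesAbove)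
    (hΔ : X₀.Δ ∈ IsLocalRing.maximalIdeal (v.adicCompletionIntegers K))
    (hc₄ : X₀.c₄ ∈ IsLocalRing.maximalIdeal (v.adicCompletionIntegers K))
    {p : ℕ} (hp : p.Prime) (hpv : (p : 𝓞 K) ∉ v.asIdeal)
    (hdvd : p ∣ (X₀.nonsingularReductionSubgroup
      (integers_valuationRing_valuation (v.adicCompletionIntegers K) (v.adicCompletion K))).index)
    (h0 : (X₀.nonsingularReductionSubgroup
      (integers_valuationRing_valuation (v.adicCompletionIntegers K) (v.adicCompletion K))).index ≠ 0) :
    ∃ R : (X₀.baseChange (v.adicCompletion K)).toAffine.Point, p • R = 0 ∧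
      R ∉ X₀.nonsingularReductionSubgroup
        (integers_valuationRing_valuation (v.adicCompletionIntegers K) (v.adicCompletion K)) := by
  haveI : Fact p.Prime := ⟨hp⟩
  set H := X₀.nonsingularReductionSubgroup
    (integers_valuationRing_valuation (v.adicCompletionIntegers K) (v.adicCompletion K)) with hH
  haveI hfinQ : Finite ((X₀.baseChange (v.adicCompletion K)).toAffine.Point ⧸ H) :=
    Nat.finite_of_card_ne_zero (by rw [← AddSubgroup.index_eq_card]; exact h0)
  obtain ⟨qt, hq⟩ := exists_prime_addOrderOf_dvd_card'
    (G := (X₀.baseChange (v.adicCompletion K)).toAffine.Point ⧸ H) p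
    (by rw [← AddSubgroup.index_eq_card]; exact hdvd)
  obtain ⟨P, rfl⟩ := QuotientAddGroup.mk_surjective qt
  have hPH : P ∉ H := fun h ↦ by
    have h1 : (QuotientAddGroup.mk P : _ ⧸ H) = 0 := (QuotientAddGroup.eq_zero_iff P).mpr h
    rw [h1, addOrderOf_zero] at hq
    exact hp.one_lt.ne hq
  have hpPH : p • P ∈ H := by
    refine (QuotientAddGroup.eq_zero_iff _).mp ?_
    rw [QuotientAddGroup.mk_nsmul, ← hq]
    exact addOrderOf_nsmul_eq_zero _
  obtain ⟨Q, hQH, hQp⟩ := X₀.exists_nsmul_eq_of_hasNonsingularReduction_of_cusp hw h𝔐 hΔ hc₄ hpv hpPH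
  refine ⟨P - Q, by rw [nsmul_sub, hQp, sub_self], fun hR ↦ hPH ?_⟩
  have := H.add_mem hR hQH
  rwa [sub_add_cancel] at this

end Cusp

end WeierstrassCurve

end
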